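import Summits.BirchSwinnertonDyer.Rank1Residual.F1Sign2.LevelZeroSpinLawAtTwo
import HarnessLib.Audit.Tags
import HarnessLib

/-!
# DESC-40 «THE TOTALLY SPLIT PLACE (`d_v = 2`)» — the quadratic form on the unramified plane is LINEAR in the conductor valuations, the lone-place trichotomy
# `(k_v, λ_v)`, and the complete LEVEL-0 law for `Δ_L < 0` (-desc g30, MEMO-desc §40; typer -ty g20)

PORT (typer -ty g20, cell bsd-f1-sign2) of -desc g30's `MEMO-desc-data/g30/lean/Sketch40.lean` 55f3b0c7b38e133f (MEMO-desc §40, memo file 8b89cac5e1f9641f).  R259d DEDUP: the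
sketch's pasted §39 vocabulary block («VERBATIM from Sketch39 — drop it when the §39 file lands») is DROPPED and the landed §39 module `LevelZeroSpinLawAtTwo.lean` (p746929)
is imported instead (builder-checked: the pasted block is byte-identical to the tree's §39 defs modulo the R253a token `0 < n ∧`, which REF1 §259 confirms «remains
cosmetic»).  §40 VOCABULARY (`def`s with parameters, VERBATIM): `HenselDatumAt ℓ F e m` (ℓ-adic Hensel datum: `ℓ^m ∥ F′(e)`, `ℓ^{2m+1} ∣ F(e)`), `ConductorOddAboveOneRoot F ℓ`
(the 𝔯-bit above `ℓ` at `d_ℓ = 1`, both branches of `𝔯 = F′(Θ)𝔇_L⁻¹`: unramified pair `v_{𝔔₂}(𝔯) = (v_ℓ(disc F) − m)/2`, ramified pair `≡ m (mod 2)`), `RescuableAt W c F v ℓ`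
(`d = 1` ∧ 𝔯 even above `ℓ`, or `d = 2` ∧ split `I_n` with `4 ∣ n`); ROWS (`@[conjecture]`, theorem-candidates modulo the LAW36′ dictionary, as -desc labels them):
**DESC-40-A** `PureSpinLawOfLoneRescuablePlaceAtTwo`, **DESC-40-B** `SpinObstructedOfOddMultiplicativeTwoModFourAnyRootAtTwo` (supersedes DESC-39-D to `d ≥ 1`), **DESC-40-D**
`SpinObstructedOfOddIstarFourComponentsAtTwo`, **LAW 40** `LevelZeroSpinLawNegDiscAtTwo` (the complete `↔` for complex cubic fields); glue `placeOver_unique`,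
`oddMult_anyRoot_of_oneRoot` (DESC-39-D's hypothesis ⟹ DESC-40-B's), `law40_pure_of_rows` (LAW 40 ⟸ from DESC-39-A + DESC-40-A; REF1: `#print axioms` = propext /
Classical.choice / Quot.sound), `law40_twoOn_not_pure` (LAW 40 ⟹ THM 39.2's statement), `law40_loneVisible_not_pure` — VERBATIM; -desc's sanity examples and REF1's probes go
to the kernel sibling `LevelZeroSpinLawNegDiscAtTwoKernel.lean`.

THE MATHEMATICS (-desc g30; REF1-audited): LEMMA 40.L — at a place with THREE local roots `e_i` (`d_v = 2`) the Poonen–Rains form on the unramified plane `N_v` is LINEAR,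
`q_v(ξ) = Σ_i [ξ_i ∉ □]·b_i (mod 2)` with `b_i = v_ℓ(F′(e_i)) = v_{𝔔_i}(𝔯)` (one line of Hilbert symbols on the diagonal CFOSS conic, which has the point `(1,1,1)` by Euler's
identity `Σ 1/F′(e_i) = 0`); THM 40.1 — the lone-place trichotomy `(k, λ)` with `k = dim 𝒲 ∩ 𝒰` (REF1 R259a CORRECTION of one cell: for odd `v₀`, `(k, λ) = (0, ≠ 0)` gives
`dim(R ∩ N) = dim U_v ∈ {0, 1}`, `r = 2 − dim U_v ∈ {1, 2}` (= 1 iff `F(ε⁺) = {v₀}`), NOT a forced `dim(R ∩ N) = 1`; corrected count line `(0,0,0,2) 2, (0,1,0,2) 6, (0,1,1,1) 6,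
(1,0,1,0) 6, (1,1,0,1) 6, (2,0,0,0) 2`; no typed row changes); KODAIRA TABLE at `d_v = 2` (split `I_n`: `k = dim 𝒲 − 1`, `λ = [n ≡ 2 (4)]`; non-split `I_n`, `n ≡ 2 (4)`: `λ = 1`,
`4 ∣ n`: OFF; `I_n*` with `c_v = 4`: `k = 0`, `λ = [n ≡ 2 (4)]`); THM 40.2 (sign-free, lone-free twist argument for PREDICTION 40X).

PORT GATE = REF1-AUDIT §259 (-ref1 g22, 2026-08-29T22:05:28Z; `REF1-data/b259/`: Probe259.lean 0b936ec0a8f94c56 rc 0 / 0 warnings, fold259 / linalg259 / lemma259 / cond259):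
**LEMMA 40.L CORRECT** (corollary of print: Serre *Cours d'arithmétique* IV Thm 6 (ii) + CFOSS08 Cor. 2.5 + PR12 §4; re-derived line by line; INDEPENDENT exhaustive numerics
37 304/37 304 unit-plane classes at `ℓ ∈ {3,5,7,11,13,2}` with three deciders); **THM 40.1 SURVIVES** with the one mis-transcribed cell of R259a (REF1's independent
Hilbert-coordinate model, 48/48); **THM 40.2 CORRECT**; typed carriers FAITHFUL — `ConductorOddAboveOneRoot (twoDivisionCubicZ …)` = the F38 ideal 𝔯-bit at **375/375** `d = 1`
census places (`ℓ = 2`: 94, odd: 281; both branches derived on paper) — R253b data-closed; re-fold (own cells, ENGINE 39 truth): LAW 40 **146/146** (`Δ_L < 0`; cross-tab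
77 / 20 / 39 / 10 — R259b: the memo's §40.3 prose 73/20/42/11 contradicts its own T40.4 lone table 21+4+12+2 = 39; bookkeeping only), typed Kodaira form 137/137, `Δ_L > 0`
12/12 (not claimed); DESC-40-A **24/24 pure** any sign (20 + 4 at `Δ_L > 0`); DESC-40-B **28/28 corrected** (the same 4 `d = 2` labels), 11 place rows; DESC-40-D 1/1 + 40X 6/6;
**R259c**: `h_L` odd (`DegOnePrimesOddClassC`) is LOAD-BEARING in sample (B14275I0s4at5n6, B19107I0s4at3n7, I4s3hevN10467a/b are h-even lone `I_n*`-c4-d2 and PURE) — rightly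
kept on 40-D / LAW 40; PREDICTION 40X CONFIRMED row by row from the raw files (arms 52/74/16; identity-arm ellrank 6/7/3; CAND40 = 6 with `[I₀*, 4, 2, 𝔯-even]`,
`loc [1,1,2,2]`, `k 0`; T38 `(0,2,0,2)` at `ℓ` 6/6, controls `r_th = 0`; S50 270 FAIL / 685 pure on the identity arm, 0 / 351 on the 3-cycle controls; law37 168 672/168 672;
`PREDICTIONS40X.md` c9d87e99cec975b8 verified).  KILLED none; PARTITION none; beyond-print theorem: no (LEMMA 40.L / THM 40.1 / THM 40.2 are corollary-of-print assemblies
on PR12 §4, CFOSS08 Cor. 2.5, Serre IV Thm 6, Poitou–Tate, MR10 Prop. 3.3; the typed rows are conjectures; the packaging «`λ_v` linear with coefficient vector `b mod 2`» + the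
lone-place rescue table is the cell's own and census-exact); bears_on stmt-23715 via the LAW36′ residual programme.  Riders R259a (header, above), R259b (to -desc), R259c
(docstrings of 40-D / LAW 40), R259d (this port: dedup done; the `𝔯 = F′(Θ)𝔇_L⁻¹` two-branch derivation stays in `ConductorOddAboveOneRoot`'s docstring).

REF2 PLACEMENT (-ref2 g58, 2026-08-29T22:05:51Z): CONCUR with -desc's §40.5 as written — LEMMA 40.L corollary-of-print (Serre *Cours* Ch. IV Thm 6 (ii) + CFOSS08 Cor 2.5 +
PR12 §4); THM 40.1 / LAW 40 NEW-COMBINATION inside LAW36′; 40X Selmer side = [cite: MazurRubin2010, Prop. 3.3] / Cor 3.4, spin side the cell's.  Two print cross-checks (R58h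
vocabulary): (a) Barrera Salazar–Pacetti–Tornaría 2021 §1/§2 EXAMPLES ([cite: BarreraPacettiTornaria2021, §2]; arXiv 2001.02263 p. 6): explicit points `P` with `δ(P) ∉
(A_{ℤ_p}^×/□)_□` — NON-NICE places in print — for `I₂` (`p` odd), `I₀*` with `A ≅ ℚ_p × ℚ_p(γ)` unramified (Ex. 2), III (Ex. 3); and Cor 1.8 (char `k > 2` + (†) ⟹ nice): DESC-40-B
and the `I_n*` `c = 4` totally-split cell (DESC-40-D) are to be checked against Ex. 1 / Ex. 2's recipe — «non-niceness witnessed in print at these Kodaira types; the spin /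
counting consequences are ours»; (b) Yoo–Yu 2022 Def 1.5 / Thm 1.6: at a totally split odd place (`d_v = 2`) `M_{1,v} = M_{2,v} = N_v` (the unramified plane), so «switch ON at
`v`» = «`E` not nice at `v`» verbatim; LEMMA 40.L's linear form `λ_v = (b mod 2)` is then a formula for the Poonen–Rains form on Y–Y's `M_{1,v}` — not in Y–Y / BPT (they never
evaluate `q` there): corollary-of-print computation, packaging new.  PARTITION: none.

DATA (-desc g30, `MEMO-desc-data/g30/`): an/lemma40L.py (640/640 pairs), an/linalg40.py, an/join40.txt (T40.1/T40.4/T40.5), ENGINE 38 LOC37/F38 rows (30/30 `d = 2` place rows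
match `(k, λ)`; lone `d = 2` places `r_pred ∋ r_th` 19/19, `#ys = 2^r − 1` 14/14), x40/ + kit/job40x (PREDICTION 40X, kit j336113), bc/bc7_40_*.lean/.out.
BSD is not proved by anything here; 23715 is not closed by anything here.
-/

noncomputable section

open scoped Classical

open WeierstrassCurve Literature.NumberTheory.EllipticCurves Literature.NumberTheory.DiophantineGeometry Polynomial IsDedekindDomain NumberField

namespace Summit.BirchSwinnertonDyer.Rank1Residual.F1Sign2

/-! ### §40 vocabulary: Hensel data and the conductor parity at any prime -/

/-- ℓ-ADIC HENSEL DATUM (generic-prime version of `HenselDatumAtTwo`): `v_ℓ(F′(e)) = m` exactly and `ℓ^{2m+1} ∣ F(e)`.  Hensel: `F` has a unique root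
`e* ∈ ℤ_ℓ` with `e* ≡ e (mod ℓ^{m+1})` and `v_ℓ(F′(e*)) = m`; conversely every root `e_i ∈ ℤ_ℓ` of a monic integral `F` has integer approximations `e` with the
datum and `m = v_ℓ(F′(e_i))`.  At a totally split prime (`L` unramified, `𝔔_i ↔ e_i`) this `m` is `v_{𝔔_i}(𝔯)`, the 𝔯-valuation above the root. -/
def HenselDatumAt (ℓ : ℕ) (F : ℤ[X]) (e : ℤ) (m : ℕ) : Prop :=
  (ℓ : ℤ) ^ m ∣ (derivative F).eval e ∧ ¬ (ℓ : ℤ) ^ (m + 1) ∣ (derivative F).eval e ∧ (ℓ : ℤ) ^ (2 * m + 1) ∣ F.eval e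

/-- THE 𝔯-BIT ABOVE `ℓ` at `d_ℓ = 1` (generic-prime version of `ConductorOddAboveTwo`, same derivation: `v_{𝔔₁}(𝔯) = m := v_ℓ(F′(e₁))` at the root; for the
degree-two prime, `v_{𝔔₂}(𝔯) = (v_ℓ(disc F) − m)/2` when the pair field `ℚ_ℓ(√disc F)` is unramified (and then `m` is even), `≡ m (mod 2)` when it is ramified
(tame: `v(disc g)` odd, `d_K = 1`; at `2`: `d_K = v₂(disc K)`)).  «Some prime of `L` over `ℓ` divides `𝔯` to an odd power.»
(RIDER, typer -ty g20: PLAIN `def` with parameters, the generic-prime ideal 𝔯-bit (R253b's requested carrier).  REF1-AUDIT §259: FAITHFUL to «some prime of `L` over `ℓ` divides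
`𝔯 = F′(Θ)𝔇_L⁻¹` to an odd power» (paper, both branches; Hensel–Rychlík pins `m` at a one-root place — unique `m` at all 459 `d = 1` places examined); `cond259.py`:
`ConductorOddAboveOneRoot (twoDivisionCubicZ …)` = the F38 ideal 𝔯-bit at **375/375** census places (`ℓ = 2`: 94 incl. 56 ramified-pair; odd `ℓ`: 281 incl. 221), 0 mismatches —
R253b data-closed; by-product: every ramified-pair `d = 1` place at 2 in the census is 𝔯-even (`m ∈ {0,4,6}`); at odd `ℓ` the ramified ON places are III (`m = 1`) ×8, III*
(`m = 3`) ×3 (𝔯-odd, visible) and `I₃*`-c4 (`m = 2`, 𝔯-even, rescued).  R259d: the two-branch derivation above is kept on purpose — it is what makes `Odd m` the right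
ramified branch.) -/
def ConductorOddAboveOneRoot (F : ℤ[X]) (ℓ : ℕ) : Prop :=
  ∃ (e : ℤ) (m : ℕ), HenselDatumAt ℓ F e m ∧
    ((QuadUnramifiedAt (cubicDiscZ F) ℓ ∧ Odd ((padicValInt ℓ (cubicDiscZ F) - m) / 2)) ∨
      (¬ QuadUnramifiedAt (cubicDiscZ F) ℓ ∧ Odd m))

/-- **RESCUABLE place** (LAW 40; point-free): `d = 1` and the conductor `𝔯` of `ℤ[Θ]` EVEN above `ℓ` (THM 37.3: the relaxed class through `ε_v` is a unit), or
`d = 2` and split multiplicative of type `I_n` with `4 ∣ n` (THM 40.1 with `k = dim 𝒲 − 1`, `λ = [n ≡ 2 (4)] = 0`: the unit `ε⁺` is forced into `R ∩ 𝒰` and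
annihilates exactly `𝒲 ∩ 𝒰`).  `c` = the cubic datum (root counts), `F` = the b-invariant 2-division cubic (conductor parity).
(RIDER, typer -ty g20: PLAIN `def` (LAW 40's point-free rescue cell).  REF1-AUDIT §259: faithful; REF2 (22:05Z): at a totally split odd place «switch ON» = «`E` not nice at `v`»
(Yoo–Yu 2022 Def 1.5) verbatim; non-nice `I₂` / `I₀*` / III places are witnessed in print by [cite: BarreraPacettiTornaria2021, §2] Examples 1–3.) -/
def RescuableAt (W : WeierstrassCurve ℚ) (c F : ℤ[X]) (v : HeightOneSpectrum (𝓞 ℚ)) (ℓ : ℕ) : Prop :=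
  (OneLocalRootC c ℓ ∧ ¬ ConductorOddAboveOneRoot F ℓ) ∨
    (ThreeLocalRootsC c ℓ ∧ W.HasSplitMultiplicativeReductionAt v ∧ ∃ n : ℕ, W.kodairaSymbolAt v = KodairaSymbol.I n ∧ 4 ∣ n)

/-! ### §40 rows -/

/-- **DESC-40-A `PureSpinLawOfLoneRescuablePlaceAtTwo` (harmless direction of LAW 40 at ANY lone place; `@[conjecture]`, theorem-candidate modulo LAW36′;
MEMO-desc §40.3).**  Setting of LAW36 with the b-invariant cubic.  If some place `v₀ ∣ ℓ₀` has every OTHER place switched off (point-free cell) and `v₀` is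
RESCUABLE — one local root and 𝔯 even above `ℓ₀` (THM 37.3, any `ℓ₀` incl. `2`), or three local roots and split `I_n` with `4 ∣ n` (THM 40.1: `k = dim 𝒲 − 1`,
`λ = 0` by LEMMA 40.L since `b = (n/2, n/2, 0)`; the class in `R ∩ 𝒰` forced by the two-Lagrangian-complements algebra is a global unit by «lone» + odd `h_L`,
hence `ε⁺` with `F(ε⁺) = {v₀}`, and `Ann_𝒲(ε⁺) = 𝒲 ∩ 𝒰`, `r = 0`) — then the PURE law fits.  No sign hypothesis (more unit classes only shrink `Ann`).
Supersedes DESC-39-C (`ℓ₀ = 2`, `d = 1`; same hypothesis up to `IsAdicSquare D 2 ↔ IsTwoAdicSquare D`) and covers the odd lone places.  BC5 (an/join40.txt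
T40.4, ENGINE 39 truth × CENSUS36, `h_L` odd): the 20 census curves whose unique switched-on place is rescuable are **20/20 pure** (odd `d = 1` 𝔯-even ×11:
`I₀*`/`I₄*` `c = 2`, `I₃*` `c = 4`, split `I₄`/`I₈`; odd split `I₄`/`I₈` `d = 2` ×2 (G1441sI4n9 at 11, H12921sI8n7 at 3); `2` with `d = 1` ×2; split
`I₄`/`I₄`/`I₄`/`I₈`/`I₁₂` at `2` with `d₂ = 2` ×5), 0 corrected; ENGINE 38 `r_th = 0` at all 20 lone places.  Cheapest falsifier RUN: «a census curve with a lone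
rescuable ON place and `ys ≠ []`» — 0 of 20.  Why it might fail: LAW36′ dictionary; at `v₀ = 2`, `d₂ = 2` the value `k = 2` for split `I_{4m}` is Tate-curve
book-keeping checked on 5/5 curves only; a mis-typed OFF cell elsewhere (0/578).  Sources: PR12 (arXiv:1104.2941) §4; CFOSS08 Cor. 2.5; Česnavičius16 Prop. 2.5 (a);
MEMO-desc §37.3, §40.
(RIDER, typer -ty g20: `@[conjecture]`, conjecture-grade, theorem-candidate modulo LAW36′; SUPERSEDES DESC-39-C (`ℓ₀ = 2`, `d = 1`) and covers the odd lone places.  REF1-AUDIT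
§259: **SURVIVES** — independent re-fold **24/24 pure, ANY sign** (`Δ_L < 0`: 20 = the memo's 20/20; `Δ_L > 0`: 4 more, all odd `d = 1`); cells odd-d1 15, odd-d2 2 (G1441sI4n9
@11 sI4, H12921sI8n7 @3 sI8), 2-d1 2, 2-d2 5; the lone hypothesis is necessary (≥ 2 ON: 0/10 pure); R259b (to -desc): note that `v₀` GOOD is allowed by the typed
hypothesis and harmless.  REF2 (22:05Z): THM 40.1 / LAW 40 NEW-COMBINATION inside LAW36′; LEMMA 40.L (the `λ = 0` criterion) corollary-of-print (Serre IV Thm 6 (ii) + CFOSS08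
Cor 2.5 + PR12 §4).  Kernel glue `law40_pure_of_rows`.) -/
@[conjecture] def PureSpinLawOfLoneRescuablePlaceAtTwo : Prop :=
  ∀ (W : WeierstrassCurve ℚ) [W.IsElliptic] [W.IsGloballyMinimal],
    ∀ (c xnum : ℤ[X]) (xden : ℕ) (B2 B4 B6 : ℤ), CubicDatumFor W c xnum xden → BInvariantsZ W B2 B4 B6 →
      selmerTwoCard W = 1 → DegOnePrimesOddClassC c →
        (∃ (v₀ : HeightOneSpectrum (𝓞 ℚ)) (ℓ₀ : ℕ), PlaceOver v₀ ℓ₀ ∧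
            (∀ (w : HeightOneSpectrum (𝓞 ℚ)) (ℓ : ℕ), PlaceOver w ℓ → w ≠ v₀ → SwitchedOffAt W c w ℓ) ∧
            RescuableAt W c (twoDivisionCubicZ B2 B4 B6) v₀ ℓ₀) →
          CorrectedSpinLawFits W c xnum xden []

/-- **DESC-40-B `SpinObstructedOfOddMultiplicativeTwoModFourAnyRootAtTwo` (visible at an odd multiplicative place, `n ≡ 2 (mod 4)`, ANY local root;
`@[conjecture]`, theorem-candidate modulo LAW36′; MEMO-desc §40.3).**  Same setting, any sign of `Δ_L`, no lone hypothesis.  If an ODD place `v` has type `I_n`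
with `n ≡ 2 (mod 4)` and the 2-division cubic has a root in `ℤ_ℓ` (`d_v ≥ 1`) then the pure law FAILS.  `d_v = 1`: DESC-39-D (𝔯 odd above `v`, COR 37.2).
`d_v = 2` (split or non-split): `k = 1` and `λ_v ≠ 0` (LEMMA 40.L, `b = (n/2, n/2, 0)` odd) ⟹ `R_v ∩ 𝒰_v ⊂ R_v ∩ (𝒲∩𝒰)^⊥` is the line through `ρ = w + x` with
`B(w, x) = λ(x) = 1`, so `ρ ∉ 𝒰`, `U_v = 0`, `r_v = rank val|𝒲 = 1`: VISIBLE (THM 40.1, sign-free, lone-free).  BC5 (an/join40.txt T40.1 + g29 T10): `d = 1`: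
24/24 census curves corrected; `d = 2`: B21003n11 (`I₂` at 17), C1n537i3, G753sI6n14 (`I₆` at 3), T2n5826i4 (`I₂` at 3, second ON place 2) **4/4 corrected**
(`ys ≠ []`), ENGINE 38 `r_th = 1` at all 11 such place rows (incl. 7 without census runs); 0 pure.  Cheapest falsifier RUN: «a census curve with such a place and
`ys = []`» — 0 of 28.  Why it might fail: LAW36′ dictionary / Chebotarev supply of a violating pure prime (the row asserts one failure); non-split `I_n` at `d = 2`
rests on 1 place row.  Sources: as DESC-40-A; Silverman AEC C.14 (Tate curve 2-torsion `x`-coordinates: `v(e₁ − e₂) = n/2`).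
(RIDER, typer -ty g20: `@[conjecture]`, conjecture-grade, theorem-candidate modulo LAW36′; SUPERSEDES DESC-39-D (`d_v = 1`) to `d_v ≥ 1` (glue `oddMult_anyRoot_of_oneRoot`).
REF1-AUDIT §259: **SURVIVES — 28/28 corrected, 0 pure**; the 4 `d = 2` instances = {B21003n11 @17 sI2, C1n537i3 @3 sI6, G753sI6n14 @3 sI6, T2n5826i4 @3 sI2} (= memo); 11 odd
`I_n`, `n ≡ 2 (4)`, `d = 2` place rows in the 202-curve population (= the memo's ENGINE 38 `r_th = 1` rows); thin: non-split `I_n` at `d = 2` rests on 1 place row.  REF2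
(22:05Z): non-nice `I₂`-type places are in print ([cite: BarreraPacettiTornaria2021, §2] Ex. 1: `y² = x(x+3p)(x+1−p)`, two congruent roots) — «non-niceness witnessed in print at
this Kodaira type; the spin consequence is the cell's».) -/
@[conjecture] def SpinObstructedOfOddMultiplicativeTwoModFourAnyRootAtTwo : Prop :=
  ∀ (W : WeierstrassCurve ℚ) [W.IsElliptic] [W.IsGloballyMinimal],
    ∀ (c xnum : ℤ[X]) (xden : ℕ), CubicDatumFor W c xnum xden →
      selmerTwoCard W = 1 → DegOnePrimesOddClassC c →
        (∃ (v : HeightOneSpectrum (𝓞 ℚ)) (ℓ n : ℕ), PlaceOver v ℓ ∧ ℓ ≠ 2 ∧ W.kodairaSymbolAt v = KodairaSymbol.I n ∧ n % 4 = 2 ∧ HasLocalRootC c ℓ) →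
          ¬ CorrectedSpinLawFits W c xnum xden []

/-- **DESC-40-D `SpinObstructedOfOddIstarFourComponentsAtTwo` (visible at an odd `I_n*` place with four rational components; `@[conjecture]`, theorem-candidate
modulo LAW36′; MEMO-desc §40.3).**  Same setting, COMPLEX cubic field (`disc c < 0`).  If an ODD place `v` has type `I_n*` (`n ≥ 0`) with `c_v = 4` and three
local roots, the pure law FAILS: there `𝒲_v ∩ 𝒰_v = 0` (`Φ_v(k) = Φ_v(k̄) = (ℤ/2)²`, `2Φ = 0`, `W⁰(ℚ_v)` 2-divisible: no non-zero Kummer class is unramified;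
Česnavičius 2.5 (a)), so `r_v = 2 − dim U_v ≥ 1` because `Δ_L < 0` leaves one candidate unit class.  Finer (THM 40.1): `n ≡ 2 (4)` ⟹ `λ ≠ 0`, `r ∈ {1, 2}`
decided by `F(ε⁺) = {v}` (K2043I2s4at3n19: `F(ε⁺) = {3}`, `r = 1`, `ys = [y]`); `4 ∣ n` (incl. `I₀*`) and `v` lone ⟹ `λ = 0 ⟹ R ∩ 𝒰 = 0 ⟹ r = 2`: THREE
correction classes, point-free (`Δ_L > 0` instance I4s3hodN14886c4: `ys = [y, y′, yy′]`, `r_th = 2` — g29's «exception» explained).  BC5: census 1/1 (`Δ_L < 0`: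
K2043) + 1 consistent `Δ_L > 0` instance; PREDICTION 40X (kit job40x, pre-registered PREDICTIONS40X.md c9d87e99cec975b8): the one-prime twists `E₀^(D)`,
`D = ±ℓ ≡ 1 (8)`, `Frob_ℓ = id`, of six all-OFF seeds put a LONE `I₀*`, `c = 4`, `d = 2`, 𝔯-even place at `ℓ` — CONFIRMED (kit j336113): 6/6 identity-arm
`Sel₂ = 0` twists (`N ≤ 6.4·10⁷`) have ENGINE 38 `r_th = 2` at `ℓ` (`𝒲∩𝒰 = 0`, `U_ℓ = 0`) and 0 elsewhere, ENGINE 52 `PURELAW_FAIL` 270 of 685 pure split primes (every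
curve > 0), law37 two ramified dual directions at `ℓ`, 168 672/168 672 cells; the 3 `Frob_ℓ = 3`-cycle controls: 351 pure primes, 0 failures (MEMO-desc §40.6).  Cheapest falsifier: a 40X twist with ≥ 100 pure primes and `PURELAW_FAIL = 0`, or `r_th(ℓ) ≠ 2`.  Why it might fail: thin census
support (1 curve) until 40X reports; LAW36′ dictionary; `Δ_L > 0` excluded on purpose (two extra unit classes could fill `R ∩ 𝒰` when `λ = 0`).  Sources: as
DESC-40-A; Kramer81 / MR10 (arXiv:0904.3709) Prop. 3.3-type local parity for the twist family.
(RIDER, typer -ty g20: `@[conjecture]`, conjecture-grade, theorem-candidate modulo LAW36′.  REF1-AUDIT §259: **SURVIVES** — in scope (`Δ_L < 0`, `h_L` odd) 1/1 (K2043I2s4at3n19 @3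
`I₂*` c4 d2, corrected) + PREDICTION 40X identity arm **6/6 CONFIRMED from the raw files** (CAND40 = 6 twists with `[I₀*, 4, 2, 𝔯-even]` at `ℓ`, ENGINE 38 `r_th = 2` at `ℓ` and 0
elsewhere, ENGINE 52 `PURELAW_FAIL` 270 of 685 pure split primes, every curve > 0; 3-cycle controls 0/351); out of scope and informative: I4s3hodN14886c4 (`Δ_L > 0`) corrected
(`r = 2`, three classes); **R259c: `DegOnePrimesOddClassC` (`h_L` odd) is KEPT and is LOAD-BEARING in sample** — the h-EVEN analogues B14275I0s4at5n6 (@5 `I₀*`),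
B19107I0s4at3n7 (@3 `I₀*`), I4s3hevN10467a/b (@3 `I₄*`) are lone `I_n*`-c4-d2 and PURE (8, 8, 16, 16 pure primes): class-group classes can fill `R ∩ 𝒰` when `λ = 0`.
REF1 R259a (THM 40.1 reading, consistent with this docstring): `n ≡ 2 (4)` ⟹ `λ ≠ 0`, `r = 2 − dim U_v ∈ {1, 2}` decided by `F(ε⁺) = {v}`.  REF2 (22:05Z): the `I₀*`
totally-split non-nice cell is witnessed in print by [cite: BarreraPacettiTornaria2021, §2] Ex. 2 (`A ≅ ℚ_p × ℚ_p(γ)` unramified); 40X's Selmer side = [cite: MazurRubin2010, Prop. 3.3] /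
Cor 3.4 (THM 40.2), the spin side the cell's.) -/
@[conjecture] def SpinObstructedOfOddIstarFourComponentsAtTwo : Prop :=
  ∀ (W : WeierstrassCurve ℚ) [W.IsElliptic] [W.IsGloballyMinimal],
    ∀ (c xnum : ℤ[X]) (xden : ℕ), CubicDatumFor W c xnum xden →
      selmerTwoCard W = 1 → DegOnePrimesOddClassC c → cubicDiscZ c < 0 →
        (∃ (v : HeightOneSpectrum (𝓞 ℚ)) (ℓ n : ℕ), PlaceOver v ℓ ∧ ℓ ≠ 2 ∧ W.kodairaSymbolAt v = KodairaSymbol.Istar n ∧ W.tamagawaNumberAt v = 4 ∧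
            ThreeLocalRootsC c ℓ) →
          ¬ CorrectedSpinLawFits W c xnum xden []

/-- **LAW 40 `LevelZeroSpinLawNegDiscAtTwo` (THE COMPLETE LEVEL-0 LAW for complex cubic fields, as an `↔`; `@[conjecture]`, theorem-candidate modulo LAW36′;
MEMO-desc §40.4).**  Setting of LAW36 with the b-invariant cubic, `disc c < 0`, and EVERY place decided by a point-free cell (switched off, or switched on — which at
`2` means multiplicative; the ten census curves with an undecided additive cell at `2` are outside).  Then the PURE `S₃`-spin law fits **iff** some place `v₀` has
every other place switched off and is itself switched off or RESCUABLE (`d = 1` ∧ 𝔯 even above it, or `d = 2` ∧ split `I_n` with `4 ∣ n`).  ⟸: DESC-39-A /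
DESC-40-A.  ⟹: two switched-on places ⟹ visible (THM 39.2, `Δ_L < 0`); a lone non-rescuable ON place is visible: `d = 1` 𝔯-odd (COR 37.2), `d = 2` multiplicative
with `n ≡ 2 (4)` (DESC-40-B), `d = 2` additive ⟹ `I_n*` with `c = 4` (the only odd additive type admitting `(ℤ/2)² ↪ Φ(k)`; DESC-40-D), at `2` with `d₂ = 2`:
split `I_n`, `n ≡ 2 (4)` (`k = 2`, `λ ≠ 0`, `r = 1`).  BC5 (an/join40.txt T40.4): ENGINE 39 truth × CENSUS36 on the 146 valid `Δ_L < 0` curves with runs: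
**146/146** (both the intrinsic `(k, λ)` form and this Kodaira form); `Δ_L > 0`: 12/12 although not claimed.  Thin spots: non-split `I_n`, `n ≡ 2 (4)` with three
roots (1 odd row, 0 rows at `2`).  Cheapest falsifier RUN: any of the 146; PREDICTION 40X adds the `I₀*`-`c 4` cell.  Why it might fail: as the four rows it
packages; the decidedness hypothesis excludes TIER-2 cells at `2` on purpose.  Sources: as DESC-40-A/B/D.
(RIDER, typer -ty g20: `@[conjecture]` — LAW 40, THE COMPLETE LEVEL-0 LAW for complex cubic fields (`↔`), theorem-candidate modulo LAW36′.  REF1-AUDIT §259: **SURVIVES —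
re-fold 146/146** (`Δ_L < 0`, intrinsic `(k, λ)` form; cross-tab `S_on = ∅` 77 pure / lone rescuable 20 pure / lone non-rescuable 39 corrected / ≥ 2 ON 10 corrected — R259b:
the memo's prose cross-tab 73/20/42/11 is a bookkeeping slip against its own T40.4), typed Kodaira form **137/137** (9 curves with an undecided cell at 2 excluded by the
decidedness hypothesis), `Δ_L > 0` 12/12 although not claimed; **R259c: `DegOnePrimesOddClassC` kept on purpose (load-bearing, see DESC-40-D)**; hypothesis mutations: `Δ_L < 0`
not exercised against in sample but THM 40.1's `λ = 0 ⟹ R ∩ N = 0` step genuinely needs ≤ 1 norm-one unit class — keep; `selmerTwoCard = 1` framework — keep.  REF2 (22:05Z):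
NEW-COMBINATION inside LAW36′ (LEMMA 40.L corollary-of-print; at a totally split odd place Yoo–Yu's `M_{1,v} = M_{2,v} = N_v`, so «ON» = «not nice» verbatim, and
`λ_v = (b mod 2)` is a formula for the Poonen–Rains form on `M_{1,v}` not found in Y–Y / BPT).  Kernel glue: `law40_pure_of_rows` (⟸), `law40_twoOn_not_pure` and
`law40_loneVisible_not_pure` (⟹ consequences).) -/
@[conjecture] def LevelZeroSpinLawNegDiscAtTwo : Prop :=
  ∀ (W : WeierstrassCurve ℚ) [W.IsElliptic] [W.IsGloballyMinimal],
    ∀ (c xnum : ℤ[X]) (xden : ℕ) (B2 B4 B6 : ℤ), CubicDatumFor W c xnum xden → BInvariantsZ W B2 B4 B6 →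
      selmerTwoCard W = 1 → DegOnePrimesOddClassC c → cubicDiscZ c < 0 →
        (∀ (v : HeightOneSpectrum (𝓞 ℚ)) (ℓ : ℕ), PlaceOver v ℓ → SwitchedOffAt W c v ℓ ∨ SwitchedOnAt W c v ℓ) →
          (CorrectedSpinLawFits W c xnum xden [] ↔
            ∃ (v₀ : HeightOneSpectrum (𝓞 ℚ)) (ℓ₀ : ℕ), PlaceOver v₀ ℓ₀ ∧
              (∀ (w : HeightOneSpectrum (𝓞 ℚ)) (ℓ : ℕ), PlaceOver w ℓ → w ≠ v₀ → SwitchedOffAt W c w ℓ) ∧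
              (SwitchedOffAt W c v₀ ℓ₀ ∨ RescuableAt W c (twoDivisionCubicZ B2 B4 B6) v₀ ℓ₀))

/-! ### kernel glue -/

/-- Kernel lemma: a finite place lies over ONE rational prime. -/
theorem placeOver_unique {v : HeightOneSpectrum (𝓞 ℚ)} {ℓ ℓ' : ℕ} (h : PlaceOver v ℓ) (h' : PlaceOver v ℓ') : ℓ = ℓ' := by
  by_contra hne
  have hcop : Nat.Coprime ℓ ℓ' := (Nat.coprime_primes h.1 h'.1).2 hne
  have hcopZ : IsCoprime (ℓ : ℤ) (ℓ' : ℤ) := by exact_mod_cast Nat.isCoprime_iff_coprime.mpr hcop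
  obtain ⟨a, b, hab⟩ := hcopZ
  have h1 : (1 : 𝓞 ℚ) ∈ v.asIdeal := by
    have key : ((a : 𝓞 ℚ) * (ℓ : 𝓞 ℚ) + (b : 𝓞 ℚ) * (ℓ' : 𝓞 ℚ)) = 1 := by exact_mod_cast congrArg (Int.cast : ℤ → 𝓞 ℚ) hab
    rw [← key]
    exact v.asIdeal.add_mem (v.asIdeal.mul_mem_left _ h.2) (v.asIdeal.mul_mem_left _ h'.2)
  exact v.isPrime.ne_top ((Ideal.eq_top_iff_one _).mpr h1)

/-- **DESC-40-B supersedes DESC-39-D's hypothesis** (one local root is a local root): the §39 row's hypothesis implies the §40 row's. -/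
theorem oddMult_anyRoot_of_oneRoot (W : WeierstrassCurve ℚ) (c : ℤ[X])
    (h : ∃ (v : HeightOneSpectrum (𝓞 ℚ)) (ℓ n : ℕ), PlaceOver v ℓ ∧ ℓ ≠ 2 ∧ W.kodairaSymbolAt v = KodairaSymbol.I n ∧ n % 4 = 2 ∧ OneLocalRootC c ℓ) :
    ∃ (v : HeightOneSpectrum (𝓞 ℚ)) (ℓ n : ℕ), PlaceOver v ℓ ∧ ℓ ≠ 2 ∧ W.kodairaSymbolAt v = KodairaSymbol.I n ∧ n % 4 = 2 ∧ HasLocalRootC c ℓ := by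
  obtain ⟨v, ℓ, n, hv, hℓ, hk, hn, h1⟩ := h
  exact ⟨v, ℓ, n, hv, hℓ, hk, hn, h1.1⟩

/-- Kernel glue (LAW 40, direction ⟸, from the two harmless rows): the right-hand side of the law implies the pure law, by DESC-39-A when `v₀` is itself off and by
DESC-40-A when it is rescuable. -/
theorem law40_pure_of_rows (h39A : PureSpinLawOfSwitchedOffReductionAtTwo) (h40A : PureSpinLawOfLoneRescuablePlaceAtTwo)
    (W : WeierstrassCurve ℚ) [W.IsElliptic] [W.IsGloballyMinimal] (c xnum : ℤ[X]) (xden : ℕ) (B2 B4 B6 : ℤ)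
    (hc : CubicDatumFor W c xnum xden) (hb : BInvariantsZ W B2 B4 B6) (hs : selmerTwoCard W = 1) (ho : DegOnePrimesOddClassC c)
    (hrhs : ∃ (v₀ : HeightOneSpectrum (𝓞 ℚ)) (ℓ₀ : ℕ), PlaceOver v₀ ℓ₀ ∧
      (∀ (w : HeightOneSpectrum (𝓞 ℚ)) (ℓ : ℕ), PlaceOver w ℓ → w ≠ v₀ → SwitchedOffAt W c w ℓ) ∧
      (SwitchedOffAt W c v₀ ℓ₀ ∨ RescuableAt W c (twoDivisionCubicZ B2 B4 B6) v₀ ℓ₀)) :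
    CorrectedSpinLawFits W c xnum xden [] := by
  obtain ⟨v₀, ℓ₀, hv₀, hoff, hcase⟩ := hrhs
  rcases hcase with hoff₀ | hresc
  · refine h39A W c xnum xden hc hs ho (fun v ℓ hv => ?_)
    by_cases hvv : v = v₀
    · subst hvv
      have : ℓ = ℓ₀ := placeOver_unique hv hv₀
      subst this
      exact hoff₀
    · exact hoff v ℓ hv hvv
  · exact h40A W c xnum xden B2 B4 B6 hc hb hs ho ⟨v₀, ℓ₀, hv₀, hoff, hresc⟩

/-- Kernel glue (LAW 40, direction ⟹ contains THM 39.2's statement): under the law, two distinct switched-on places forbid the pure law. -/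
theorem law40_twoOn_not_pure (hlaw : LevelZeroSpinLawNegDiscAtTwo)
    (W : WeierstrassCurve ℚ) [W.IsElliptic] [W.IsGloballyMinimal] (c xnum : ℤ[X]) (xden : ℕ) (B2 B4 B6 : ℤ)
    (hc : CubicDatumFor W c xnum xden) (hb : BInvariantsZ W B2 B4 B6) (hs : selmerTwoCard W = 1) (ho : DegOnePrimesOddClassC c) (hneg : cubicDiscZ c < 0)
    (hdec : ∀ (v : HeightOneSpectrum (𝓞 ℚ)) (ℓ : ℕ), PlaceOver v ℓ → SwitchedOffAt W c v ℓ ∨ SwitchedOnAt W c v ℓ)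
    (htwo : ∃ (v v' : HeightOneSpectrum (𝓞 ℚ)) (ℓ ℓ' : ℕ), v ≠ v' ∧ PlaceOver v ℓ ∧ PlaceOver v' ℓ' ∧ SwitchedOnAt W c v ℓ ∧ SwitchedOnAt W c v' ℓ') :
    ¬ CorrectedSpinLawFits W c xnum xden [] := by
  intro hpure
  obtain ⟨v₀, ℓ₀, -, hoff, -⟩ := (hlaw W c xnum xden B2 B4 B6 hc hb hs ho hneg hdec).mp hpure
  obtain ⟨v, v', ℓ, ℓ', hne, hv, hv', hon, hon'⟩ := htwo
  by_cases h : v = v₀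
  · exact hon'.1 (hoff v' ℓ' hv' (fun h' => hne (h.trans h'.symm)))
  · exact hon.1 (hoff v ℓ hv h)

/-- Kernel glue (LAW 40, direction ⟹, lone case): under the law, a switched-on place that is not rescuable and has every other place off forbids the pure law. -/
theorem law40_loneVisible_not_pure (hlaw : LevelZeroSpinLawNegDiscAtTwo)
    (W : WeierstrassCurve ℚ) [W.IsElliptic] [W.IsGloballyMinimal] (c xnum : ℤ[X]) (xden : ℕ) (B2 B4 B6 : ℤ)
    (hc : CubicDatumFor W c xnum xden) (hb : BInvariantsZ W B2 B4 B6) (hs : selmerTwoCard W = 1) (ho : DegOnePrimesOddClassC c) (hneg : cubicDiscZ c < 0)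
    (hdec : ∀ (v : HeightOneSpectrum (𝓞 ℚ)) (ℓ : ℕ), PlaceOver v ℓ → SwitchedOffAt W c v ℓ ∨ SwitchedOnAt W c v ℓ)
    {v₀ : HeightOneSpectrum (𝓞 ℚ)} {ℓ₀ : ℕ} (hv₀ : PlaceOver v₀ ℓ₀) (hon : SwitchedOnAt W c v₀ ℓ₀)
    (hnresc : ¬ RescuableAt W c (twoDivisionCubicZ B2 B4 B6) v₀ ℓ₀) :
    ¬ CorrectedSpinLawFits W c xnum xden [] := by
  intro hpure
  obtain ⟨v₁, ℓ₁, hv₁, hoff, hcase⟩ := (hlaw W c xnum xden B2 B4 B6 hc hb hs ho hneg hdec).mp hpure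
  by_cases h : v₀ = v₁
  · subst h
    have : ℓ₁ = ℓ₀ := placeOver_unique hv₁ hv₀
    subst this
    rcases hcase with hoff₀ | hresc
    · exact hon.1 hoff₀
    · exact hnresc hresc
  · exact hon.1 (hoff v₀ ℓ₀ hv₀ h)

end Summit.BirchSwinnertonDyer.Rank1Residual.F1Sign2

end
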